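import Summits.BirchSwinnertonDyer.Rank1Residual.X9.PrintCertBridge
import Literature.NumberTheory.EllipticCurves.ModThreeFiveImageJLines
import HarnessLib

/-!
# Leaves X9 / X10b — per-pair certificate records: `¬Surj` IN THE KERNEL from the image certificate, modulo
# Zywina's `j`-line theorems (companion of `X9/PrintCertSchema.lean`, `X9/PrintCertBridge.lean`)

HONEST FRAMING (cell `bsd-print-x9`, D-0131 (2) print tier; partition leaves `ClassX9` and
`ClassX10 ∧ ¬Surj`): theorems only; no named fact introduced here; no leaf claimed closed. The record's image
certificate `imageCert = some (u, v)` says `j(E) = J_G(u/v)` for Zywina's `j`-map of the recorded image type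
(`3Ns`/`3Nn`/`5Ns`/`5S4`/`7Ns`), and `Record.check` re-verifies `c₄³·B(u,v) = Δ·A(u,v)` exactly. For ANY
globally minimal elliptic `W` with the record's integral model (`hI`), this file turns that identity into
`j(W)·D(t) = N(t)` (`t = u/v`, Zywina's printed `J_G = N/D`) and feeds it, with `¬CM` from the recheck, to the
PUBLISHED `j`-line criteria — the tree's named facts `zywina2015_thm12_not_surjective_three_of_j_eq_J2/J4`,
`zywina2015_thm14_not_surjective_five_of_j_eq_J4/J9` (`Literature/…/ModThreeFiveImageJLines.lean`) and
`zywina2015_thm15_not_surjective_seven_of_j_eq_J2` (`ModSevenImageSplitCartanJLine.lean`), all taken as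
HYPOTHESES — to get `¬Surj W p` (`not_surj_of_check`). Hence the leaf predicates with ONE remaining claim, the
analytic rank: `classX9_of_check_of_jLines`, `classX10b_of_check_of_jLines`.
References: [Zywina2015] §1.2–1.4, Thm. 1.2, 1.4, 1.5; [SilvermanAEC2009] III.1.
-/

set_option autoImplicit false

noncomputable section

open scoped Classical

open WeierstrassCurve Literature.NumberTheory.EllipticCurves Literature.NumberTheory.EllipticCurves.Rank1Residual
  Literature.NumberTheory.EllipticCurves.Rank1Residual.X11RankOneCertificates
  Summit.BirchSwinnertonDyer.BirchSwinnertonDyer.Rank1Residual.IntModel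

namespace Summit.BirchSwinnertonDyer.Rank1Residual.X9.PrintCert

namespace Record

variable (r : Record)

section Image

variable {W : WeierstrassCurve ℚ} [W.IsElliptic] [W.IsGloballyMinimal] (hI : integralModelInt W = r.intCurve)
include hI

/-- The rechecked image certificate read in `ℚ`: `j(W)·B(u,v) = A(u,v)` with `v ≠ 0` and `B(u,v) ≠ 0`
(`j = c₄³/Δ` on the integral model and `c₄³·B = Δ·A`). [cite: SilvermanAEC2009, III.1 (p. 42)] -/
theorem j_mul_jMapDen_eq_of_check (hc : r.check = true) {u v : ℤ} (huv : r.imageCert = some (u, v)) :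
    W.j * (jMapDen r.imageType u v : ℚ) = jMapNum r.imageType u v ∧ v ≠ 0 ∧ jMapDen r.imageType u v ≠ 0 := by
  obtain ⟨a1, a2, a3, a4, a6, hA, hne⟩ := r.ainvs_spec_of_check hc
  have hW : integralModelInt W = ⟨a1, a2, a3, a4, a6⟩ := by rw [hI, intCurve_eq hA]
  have him := r.passImage_of_check hc
  rw [passImage, huv] at him
  simp only [Bool.and_eq_true, decide_eq_true_eq] at him
  obtain ⟨⟨hv, hden⟩, hid⟩ := him
  rw [hA] at hid
  refine ⟨?_, hv, hden⟩
  have hΔq : ((discOf [a1, a2, a3, a4, a6] : ℤ) : ℚ) ≠ 0 := by exact_mod_cast hne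
  have hid' : c4Of [a1, a2, a3, a4, a6] ^ 3 * jMapDen r.imageType u v =
      jMapNum r.imageType u v * discOf [a1, a2, a3, a4, a6] := by rw [hid, mul_comm]
  rw [j_eq_of_intModel a1 a2 a3 a4 a6 hW, div_mul_eq_mul_div, div_eq_iff hΔq]
  exact_mod_cast hid'

/-- **`¬Surj W p` from the image certificate**, modulo Zywina's `j`-line theorems (named facts, hypotheses
`h3s h3n h5s h5e h7`): `j(W) = J_G(u/v)` for the proper subgroup `G` of the recorded type and `W` is not CM
(recheck), so `ρ̄_{W,p}` is not surjective. [cite: Zywina2015, Thm. 1.2, 1.4, 1.5 (second items)] -/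
theorem not_surj_of_check (hc : r.check = true) (hsome : r.imageCert.isSome = true)
    (h3s : zywina2015_thm12_not_surjective_three_of_j_eq_J2)
    (h3n : zywina2015_thm12_not_surjective_three_of_j_eq_J4)
    (h5s : zywina2015_thm14_not_surjective_five_of_j_eq_J4)
    (h5e : zywina2015_thm14_not_surjective_five_of_j_eq_J9)
    (h7 : zywina2015_thm15_not_surjective_seven_of_j_eq_J2) {q : ℕ} [Fact q.Prime] (hq : q = r.p) :
    ¬ Surj W q := by
  obtain ⟨⟨u, v⟩, huv⟩ := Option.isSome_iff_exists.mp hsome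
  obtain ⟨hj, hv, hden⟩ := r.j_mul_jMapDen_eq_of_check hI hc huv
  have hCM := r.not_hasCM_of_check hI hc
  have hp := r.p_eq_prime_of_check hc
  subst hq
  show ¬ W.HasSurjectiveModNGaloisRep (r.p : ℤ)
  rw [hp]
  have hvq : (v : ℚ) ≠ 0 := by exact_mod_cast hv
  have hdenq : (jMapDen r.imageType u v : ℚ) ≠ 0 := by exact_mod_cast hden
  -- dehomogenise: `u = t·v` with `t = u/v`
  obtain ⟨t, ht⟩ : ∃ t : ℚ, (u : ℚ) = t * v := ⟨u / v, by rw [div_mul_cancel₀ _ hvq]⟩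
  cases hT : r.imageType <;>
    simp only [hT, jMapNum, jMapDen, ImageType.prime, ne_eq, Int.cast_mul, Int.cast_pow, Int.cast_add,
      Int.cast_sub, Int.cast_ofNat, mul_eq_zero, not_or] at hj hdenq ⊢ <;> rw [ht] at hj
  · -- `3Ns`: `J₂` at `3`; `t ≠ 0` since `u ≠ 0`
    refine h3s W hCM t ?_ (mul_left_cancel₀ (pow_ne_zero 6 hvq) (by linear_combination hj))
    rintro rfl
    exact hdenq.1 (by rw [ht]; ring)
  · -- `3Nn`: `J₄(t) = t³` at `3`
    exact h3n W hCM t (mul_left_cancel₀ (pow_ne_zero 3 hvq) (by linear_combination hj))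
  · -- `5Ns`: `J₄` at `5`; `t² + 5t + 5 ≠ 0` since `u² + 5uv + 5v² ≠ 0`
    refine h5s W hCM t ?_ (mul_left_cancel₀ (pow_ne_zero 15 hvq) (by linear_combination hj))
    intro h0
    exact hdenq.1 (by rw [ht]; linear_combination (v : ℚ) ^ 10 * (t ^ 2 + 5 * t + 5) ^ 4 * h0)
  · -- `5S4`: `J₉(t) = t³(t² + 5t + 40)` at `5`
    exact h5e W hCM t (mul_left_cancel₀ (pow_ne_zero 5 hvq) (by linear_combination hj))
  · -- `7Ns`: `J₂` at `7`; `t³ − 4t² + 3t + 1 ≠ 0` since `u³ − 4u²v + 3uv² + v³ ≠ 0`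
    refine h7 W hCM t ?_ (mul_left_cancel₀ (pow_ne_zero 28 hvq) (by linear_combination hj))
    intro h0
    exact hdenq.1 (by
      rw [ht]; linear_combination (v : ℚ) ^ 21 * (t ^ 3 - 4 * t ^ 2 + 3 * t + 1) ^ 6 * h0)

/-- **The leaf predicate X9 with ONE remaining claim** (`p ≥ 5`): `¬CM ∧ GoodOrd ∧ Irr` from the recheck,
`¬Surj` from the image certificate modulo Zywina's `j`-line theorems, the analytic rank `hrank` the record's
CLAIM. [cite: Zywina2015, Thm. 1.4, 1.5 (second items)] -/
theorem classX9_of_check_of_jLines (hc : r.check = true) (hsome : r.imageCert.isSome = true)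
    (h3s : zywina2015_thm12_not_surjective_three_of_j_eq_J2)
    (h3n : zywina2015_thm12_not_surjective_three_of_j_eq_J4)
    (h5s : zywina2015_thm14_not_surjective_five_of_j_eq_J4)
    (h5e : zywina2015_thm14_not_surjective_five_of_j_eq_J9)
    (h7 : zywina2015_thm15_not_surjective_seven_of_j_eq_J2) {q : ℕ} [Fact q.Prime] (hq : q = r.p)
    (hp5 : 5 ≤ q) (hrank : W.analyticRank = r.rank) : ClassX9 W q :=
  r.classX9_of_check hI hc hq hp5 (r.not_surj_of_check hI hc hsome h3s h3n h5s h5e h7 hq) hrank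

/-- **The leaf predicate X10b with ONE remaining claim** (`p = 3`): `ClassX10 W 3 ∧ ¬Surj W 3` from the
recheck ((ram)/semistability, good ordinary, irreducible), the image certificate modulo Zywina's `j`-line
theorems, and the analytic rank CLAIM `hrank`. [cite: Zywina2015, Thm. 1.2 (second item)] -/
theorem classX10b_of_check_of_jLines (hc : r.check = true) (hsome : r.imageCert.isSome = true)
    (h3s : zywina2015_thm12_not_surjective_three_of_j_eq_J2)
    (h3n : zywina2015_thm12_not_surjective_three_of_j_eq_J4)
    (h5s : zywina2015_thm14_not_surjective_five_of_j_eq_J4)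
    (h5e : zywina2015_thm14_not_surjective_five_of_j_eq_J9)
    (h7 : zywina2015_thm15_not_surjective_seven_of_j_eq_J2) (hp3 : r.p = 3)
    (hrank : W.analyticRank = r.rank) : ClassX10 W 3 ∧ ¬ Surj W 3 :=
  ⟨r.classX10_of_check hI hc hp3 hp3.symm hrank, r.not_surj_of_check hI hc hsome h3s h3n h5s h5e h7 hp3.symm⟩

end Image

end Record

end Summit.BirchSwinnertonDyer.Rank1Residual.X9.PrintCert

end
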